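import Literature.Geometry.Lorentzian.KerrStarChartBounds
import Literature.Geometry.Lorentzian.KerrSchildDivergence
import Literature.Geometry.Lorentzian.KerrEnergyIdentity
import HarnessLib

/-!
# Decay of the first derivatives of the Kerr–Schild components: `∂g⁻¹ = O(M/r²)`

(family `gr`; infrastructure for the physical-space multiplier estimates behind statement
**gr.S24** — Dafermos–Rodnianski–Shlapentokh-Rothman, arXiv:1402.7034 = Ann. of Math. 183 (2016),
§4.6, Prop. 4.6.1 (the large-`r` current: "this inequality is preserved when `X`, `w` are defined
for `g_{M,a}`"; Dafermos–Rodnianski arXiv:1010.5132, §6) — namespace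
`Literature.Geometry.Lorentzian.Kerr`)

The large-`r` positivity of the Dafermos–Rodnianski current survives the passage from the model
metric to Kerr because the inverse Kerr metric in Kerr–Schild coordinates,
`g^{μν} = η^{μν} − 2H ℓ^μ ℓ^ν` (`Kerr.inverseMetric_apply`), differs from `η^{μν}` by
`|g^{μν} − η^{μν}| ≤ 2H ≤ 2M/r` (`Kerr.abs_inverseMetric_sub_etaComp_le`, `Kerr.scalarH_le_div`)
**and its first derivatives decay one order faster**, `|∂_μ g^{αβ}| ≤ C M/r²`. The perturbation
lemma `KerrSchild.multiplierBulk_ge_of_perturbation` (`KerrSchildMultiplierPerturbation.lean`)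
consumes exactly these two pointwise bounds (`h₀`, `h₁`). This file proves the second one, with
explicit (crude) constants, at every point `x` with `r = r(x) > 0`, writing `K = 1 + |a|/r`
(so `K ≤ 2` on `{r ≥ |a|}`):

* `Kerr.abs_fderiv_radius_basisVector_le` — `|∂_μ r| ≤ K` (from `‖∇r‖² = (r² + a²)/Σ ≤ 1 + a²/r²`,
  `Kerr.norm_radiusGrad_sq_le`);
* `Kerr.hasFDerivAt_blSigma`, `Kerr.norm_fderiv_blSigma_le` — `dΣ = 4r dr − 2⟨y, ·⟩`,
  `‖dΣ‖ ≤ 6(r + |a|)` for `Σ = 2r² − ‖y‖² + a²` (`Kerr.blSigma`);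
* `Kerr.hasFDerivAt_scalarH_slice`, `Kerr.norm_fderiv_scalarH_slice_le`,
  `Kerr.abs_fderiv_scalarH_basisVector_le` — `H = M r/Σ` has `|∂_μ H| ≤ 7K|M|/r²` (`Σ ≥ r²`);
* `Kerr.norm_fderiv_nullSpatial_slice_le_radius`, `Kerr.abs_fderiv_nullVector_basisVector_le` —
  `|∂_μ ℓ^ν| ≤ (21K + 5)/r` (the bound `(21(1 + |a|/r₀) + 5)/r₀` of
  `Kerr.norm_fderiv_nullSpatial_slice_le` on `{r > r₀}`, `KerrStarChartBounds.lean`, passed to the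
  limit `r₀ ↑ r`);
* `Kerr.abs_fderiv_inverseMetric_basisVector_le` — **`|∂_μ g^{αβ}| ≤ (98K + 20) M/r²`** for
  `M ≥ 0` (product rule on `2H ℓ^β ℓ^α` with `|ℓ^ν| ≤ 1`, `0 ≤ H ≤ M/r`), and
  `Kerr.abs_fderiv_inverseMetric_basisVector_le_of_abs_le` — `≤ 216 M/r²` on `{r ≥ |a|}`;
* `Kerr.abs_inverseMetric_sub_eta_apply_le`, `Kerr.abs_fderiv_inverseMetric_sub_eta_basisVector_le`
  — the same two bounds in the form `(G − G') x α β`, `G = Kerr.inverseMetric M a`,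
  `G' = fun _ ↦ Kerr.etaComp`, in which `KerrSchild.multiplierBulk_ge_of_perturbation` takes them.

The passage from the slice `{t* = 0}` (where `KerrHyperboloidalLeaves.lean` and
`KerrStarChartBounds.lean` differentiate `r`, `ℓ⃗` as functions of `y ∈ E3`) to functions on `E4`
is the chain rule through the spatial projection for time-translation invariant functions
(`Kerr.eq_slice_spatial_of_time_invariant`, `Kerr.hasFDerivAt_of_time_invariant`,
`Kerr.abs_comp_spatial_basisVector_le`): all Kerr–Schild components are stationary
(`KerrSchildCoord.lean`, `Kerr.*_add_smul_basisVector_zero`), so `∂_{t*}` of each vanishes and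
`∂_{i+1}` is the slice derivative in the direction `e_i`.

No definitions, no named facts (D-0026).

## References

* M. Dafermos, I. Rodnianski, Y. Shlapentokh-Rothman, *Decay for solutions of the wave equation on
  Kerr exterior spacetimes III: the full subextremal case `|a| < M`*, Ann. of Math. 183 (2016),
  arXiv:1402.7034, §4.6, Prop. 4.6.1 (key `DafermosRodnianskiShlapentokhrothman2014`).
* M. Dafermos, I. Rodnianski, *Decay for solutions of the wave equation on Kerr exterior spacetimes
  I–II: the cases `|a| ≪ M` or axisymmetry*, arXiv:1010.5132, §6 (key `DafermosRodnianski2010`).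
* M. Visser, *The Kerr spacetime: a brief introduction*, arXiv:0706.0622, (33)–(35) (key
  `arXiv07060622`).
-/

noncomputable section

open Set Filter
open scoped Topology Real

namespace Literature.Geometry.Lorentzian.Kerr

/-! ### Time-invariant functions on `E4` are slice functions of the spatial part -/

/-- A time-translation invariant function on `E4` is its slice function evaluated at the spatial
part: `F(x) = F(0, x⃗)` (`x = (0, x⃗) + t* ∂_{t*}`). [folklore] -/
theorem eq_slice_spatial_of_time_invariant {α : Type*} {F : E4 → α}
    (hF : ∀ (x : E4) (t : ℝ), F (x + t • E4.basisVector 0) = F x) (x : E4) :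
    F x = F (E4.ofTimeSpace 0 (E4.spatial x)) := by
  have hx : x = E4.ofTimeSpace 0 (E4.spatial x) + E4.time x • E4.basisVector 0 := by
    conv_lhs => rw [← E4.ofTimeSpace_time_spatial x, E4.ofTimeSpace_eq_smul_add']
    rw [E4.spaceEmbed_apply, add_comm]
  conv_lhs => rw [hx]
  exact hF _ _

/-- **Chain rule through the spatial projection**: if `F : E4 → ℝ` is invariant under
`t*`-translations and its slice function `y ↦ F(0, y)` has derivative `f'` at `x⃗`, then `F` has
derivative `f' ∘ (x ↦ x⃗)` at `x` (so `∂_{t*}F = 0` and `∂_{i+1}F = f'(e_i)`). [folklore] -/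
theorem hasFDerivAt_of_time_invariant {F : E4 → ℝ}
    (hF : ∀ (x : E4) (t : ℝ), F (x + t • E4.basisVector 0) = F x) {x : E4} {f' : E3 →L[ℝ] ℝ}
    (hf : HasFDerivAt (fun y ↦ F (E4.ofTimeSpace 0 y)) f' (E4.spatial x)) :
    HasFDerivAt F (f'.comp E4.spatial) x := by
  have h := hf.comp x E4.spatial.hasFDerivAt
  exact h.congr_of_eventuallyEq
    (Eventually.of_forall fun z ↦ eq_slice_spatial_of_time_invariant hF z)

/-- The coordinate components of `f' ∘ (x ↦ x⃗)` are bounded by the operator norm of `f'`: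
`|(f' ∘ spatial)(∂_μ)| ≤ ‖f'‖` (`spatial ∂₀ = 0`, `spatial ∂_{i+1} = e_i`, `‖e_i‖ = 1`). [folklore] -/
theorem abs_comp_spatial_basisVector_le (f' : E3 →L[ℝ] ℝ) (μ : Fin 4) :
    |(f'.comp E4.spatial) (E4.basisVector μ)| ≤ ‖f'‖ := by
  rw [ContinuousLinearMap.comp_apply]
  refine Fin.cases ?_ (fun i ↦ ?_) μ
  · rw [E4.spatial_basisVector_zero, map_zero, abs_zero]
    exact norm_nonneg _
  · rw [E4.spatial_basisVector_succ]
    have h := f'.le_opNorm (EuclideanSpace.single i (1 : ℝ))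
    rw [PiLp.norm_single, norm_one, mul_one, Real.norm_eq_abs] at h
    exact h

/-- A bound `c ≤ f(r₀)` valid for every `0 < r₀ < r`, with `f` continuous at `r > 0`, holds at
`r₀ = r` (the uniform bounds of `KerrStarChartBounds.lean` on `{r > r₀}` pass to the sharp
threshold). [folklore] -/
theorem le_of_forall_lt_of_continuousAt {c r : ℝ} (hr : 0 < r) {f : ℝ → ℝ}
    (hf : ContinuousAt f r) (h : ∀ r₀, 0 < r₀ → r₀ < r → c ≤ f r₀) : c ≤ f r := by
  have ht : Tendsto f (𝓝[<] r) (𝓝 (f r)) := hf.tendsto.mono_left nhdsWithin_le_nhds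
  refine ge_of_tendsto ht ?_
  filter_upwards [Ioo_mem_nhdsLT hr] with r₀ hr₀ using h r₀ hr₀.1 hr₀.2

/-! ### On the slice `{t* = 0}`: `dr`, `dΣ`, `dH`, `dℓ⃗` at a point with `r > 0` -/

section Slice

variable {a : ℝ} {y : E3}

/-- **Pointwise bound of the gradient of the Kerr–Schild radius**: `‖∇r‖ ≤ 1 + |a|/r` at a point
of the slice with `r = r(0, y) > 0` (`‖∇r‖² = (r² + a²)/Σ ≤ 1 + a²/r²`). Visser arXiv:0706.0622,
(35). [cite: arXiv07060622, (35)] -/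
theorem norm_radiusGrad_le_radius (hr : 0 < radius a (E4.ofTimeSpace 0 y)) :
    ‖radiusGrad a y‖ ≤ 1 + |a| / radius a (E4.ofTimeSpace 0 y) := by
  have h1 : ‖radiusGrad a y‖ ^ 2 ≤ (1 + |a| / radius a (E4.ofTimeSpace 0 y)) ^ 2 :=
    calc ‖radiusGrad a y‖ ^ 2 ≤ 1 + a ^ 2 / radius a (E4.ofTimeSpace 0 y) ^ 2 :=
          norm_radiusGrad_sq_le hr
      _ ≤ (1 + |a| / radius a (E4.ofTimeSpace 0 y)) ^ 2 := by
          have hsq : (|a| / radius a (E4.ofTimeSpace 0 y)) ^ 2 =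
              a ^ 2 / radius a (E4.ofTimeSpace 0 y) ^ 2 := by rw [div_pow, sq_abs]
          nlinarith [div_nonneg (abs_nonneg a) hr.le]
  exact (abs_le_of_sq_le_sq' h1 (by positivity)).2

/-- **Derivative of `Σ = 2r² − ‖y‖² + a²` along the slice**: `dΣ = 4r dr − 2⟨y, ·⟩` wherever
`r > 0` (`Kerr.hasFDerivAt_radius_slice`). DRSR arXiv:1402.7034, §2.1.1 (`ρ² = r² + a² cos²θ`).
[folklore] -/
theorem hasFDerivAt_blSigma (hr : 0 < radius a (E4.ofTimeSpace 0 y)) :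
    HasFDerivAt (blSigma a)
      ((4 * radius a (E4.ofTimeSpace 0 y)) • radiusGrad a y -
        (2 : ℝ) • (innerSL ℝ y : E3 →L[ℝ] ℝ)) y := by
  have hN := hasFDerivAt_radius_sq_add_sq (a := a) hr
  have hn : HasFDerivAt (fun y' : E3 ↦ ‖y'‖ ^ 2) (2 • (innerSL ℝ y : E3 →L[ℝ] ℝ)) y :=
    (hasStrictFDerivAt_norm_sq y).hasFDerivAt
  have h : HasFDerivAt
      (fun y' : E3 ↦ 2 * (radius a (E4.ofTimeSpace 0 y') ^ 2 + a ^ 2) - ‖y'‖ ^ 2 - a ^ 2)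
      ((2 : ℝ) • (radius a (E4.ofTimeSpace 0 y) • radiusGrad a y +
          radius a (E4.ofTimeSpace 0 y) • radiusGrad a y) -
        2 • (innerSL ℝ y : E3 →L[ℝ] ℝ)) y :=
    ((hN.const_mul 2).sub hn).sub_const (a ^ 2)
  have hfun : blSigma a = fun y' : E3 ↦
      2 * (radius a (E4.ofTimeSpace 0 y') ^ 2 + a ^ 2) - ‖y'‖ ^ 2 - a ^ 2 := by
    funext y'
    unfold blSigma
    ring
  rw [hfun]
  refine h.congr_fderiv ?_
  ext v
  simp only [sub_apply, smul_apply, add_apply, smul_eq_mul, nsmul_eq_mul, Nat.cast_ofNat]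
  ring

/-- **`‖dΣ‖ ≤ 6(r + |a|)`** at a point of the slice with `r > 0` (`‖dr‖ ≤ 1 + |a|/r`,
`‖y‖ ≤ r + |a|`, `Kerr.norm_le_radius_add_abs`). [folklore] -/
theorem norm_fderiv_blSigma_le (hr : 0 < radius a (E4.ofTimeSpace 0 y)) :
    ‖(4 * radius a (E4.ofTimeSpace 0 y)) • radiusGrad a y -
        (2 : ℝ) • (innerSL ℝ y : E3 →L[ℝ] ℝ)‖ ≤ 6 * (radius a (E4.ofTimeSpace 0 y) + |a|) := by
  have hK := norm_radiusGrad_le_radius hr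
  have hy := norm_le_radius_add_abs hr
  set r := radius a (E4.ofTimeSpace 0 y) with hr_def
  have h1 : ‖(4 * r) • radiusGrad a y‖ ≤ 4 * (r + |a|) := by
    rw [norm_smul, Real.norm_eq_abs, abs_of_pos (by positivity)]
    calc 4 * r * ‖radiusGrad a y‖ ≤ 4 * r * (1 + |a| / r) := by gcongr
      _ = 4 * (r + |a|) := by field_simp
  have h2 : ‖(2 : ℝ) • (innerSL ℝ y : E3 →L[ℝ] ℝ)‖ ≤ 2 * (r + |a|) := by
    rw [norm_smul, Real.norm_eq_abs, abs_of_pos two_pos, innerSL_apply_norm]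
    linarith
  calc _ ≤ ‖(4 * r) • radiusGrad a y‖ + ‖(2 : ℝ) • (innerSL ℝ y : E3 →L[ℝ] ℝ)‖ := norm_sub_le _ _
    _ ≤ 4 * (r + |a|) + 2 * (r + |a|) := add_le_add h1 h2
    _ = 6 * (r + |a|) := by ring

/-- `H = M r/Σ` at every point `(t, y)` — also on the disc `{r = 0}`, where both sides vanish
(`H = M r³/(r⁴ + a²z²)`; `Kerr.scalarH_ofTimeSpace_eq` off the disc). Visser arXiv:0706.0622,
(33). [cite: arXiv07060622, (33)] -/
theorem scalarH_ofTimeSpace_eq_div (M a t : ℝ) (y : E3) :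
    scalarH M a (E4.ofTimeSpace t y) = M * radius a (E4.ofTimeSpace 0 y) / blSigma a y := by
  rcases (radius_nonneg a (E4.ofTimeSpace 0 y)).eq_or_lt with h0 | hpos
  · have ht : radius a (E4.ofTimeSpace t y) = 0 := by rw [radius_ofTimeSpace]; exact h0.symm
    rw [← h0]
    simp [scalarH, ht]
  · exact scalarH_ofTimeSpace_eq t hpos

/-- **Derivative of `H = M r/Σ` along the slice** (quotient rule; `Kerr.hasFDerivAt_radius_slice`,
`Kerr.hasFDerivAt_blSigma`), wherever `r > 0`. Visser arXiv:0706.0622, (33). [cite: arXiv07060622, (33)] -/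
theorem hasFDerivAt_scalarH_slice (M : ℝ) (hr : 0 < radius a (E4.ofTimeSpace 0 y)) :
    HasFDerivAt (fun y ↦ scalarH M a (E4.ofTimeSpace 0 y))
      ((M * radius a (E4.ofTimeSpace 0 y)) •
          ((-(blSigma a y ^ 2)⁻¹) •
            ((4 * radius a (E4.ofTimeSpace 0 y)) • radiusGrad a y -
              (2 : ℝ) • (innerSL ℝ y : E3 →L[ℝ] ℝ))) +
        (blSigma a y)⁻¹ • (M • radiusGrad a y)) y := by
  have hfun : (fun y : E3 ↦ scalarH M a (E4.ofTimeSpace 0 y)) =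
      fun y ↦ M * radius a (E4.ofTimeSpace 0 y) * (blSigma a y)⁻¹ := by
    funext y
    rw [scalarH_ofTimeSpace_eq_div, div_eq_mul_inv]
  rw [hfun]
  have hP := (hasFDerivAt_radius_slice hr).const_mul M
  have hinv := (hasDerivAt_inv (blSigma_pos hr).ne').comp_hasFDerivAt y (hasFDerivAt_blSigma hr)
  exact hP.mul hinv

/-- **`|dH| ≤ 7(1 + |a|/r)|M|/r²`** at a point of the slice with `r > 0`: from
`dH = −(Mr/Σ²) dΣ + (M/Σ) dr`, `‖dΣ‖ ≤ 6(r + |a|)`, `‖dr‖ ≤ 1 + |a|/r` and `Σ ≥ r²`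
(`Kerr.sq_le_blSigma`). This is the `O(M/r²)` decay of `∂H` behind DRSR arXiv:1402.7034, §4.6.
[folklore] -/
theorem norm_fderiv_scalarH_slice_le (M : ℝ) (hr : 0 < radius a (E4.ofTimeSpace 0 y)) :
    ‖fderiv ℝ (fun y ↦ scalarH M a (E4.ofTimeSpace 0 y)) y‖ ≤
      7 * (1 + |a| / radius a (E4.ofTimeSpace 0 y)) * |M| / radius a (E4.ofTimeSpace 0 y) ^ 2 := by
  have hdS := norm_fderiv_blSigma_le hr
  have hdr := norm_radiusGrad_le_radius hr
  have hSle := sq_le_blSigma hr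
  have hSpos := blSigma_pos hr
  rw [(hasFDerivAt_scalarH_slice M hr).fderiv]
  set r := radius a (E4.ofTimeSpace 0 y) with hr_def
  set S := blSigma a y with hS_def
  have h1 : ‖(M * r) • ((-(S ^ 2)⁻¹) • ((4 * r) • radiusGrad a y -
      (2 : ℝ) • (innerSL ℝ y : E3 →L[ℝ] ℝ)))‖ ≤ |M| * r * (S ^ 2)⁻¹ * (6 * (r + |a|)) := by
    rw [norm_smul, norm_smul, Real.norm_eq_abs, Real.norm_eq_abs, abs_mul, abs_of_pos hr, abs_neg,
      abs_inv, abs_of_pos (by positivity : (0 : ℝ) < S ^ 2)]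
    have : 0 ≤ |M| * r * (S ^ 2)⁻¹ := by positivity
    calc |M| * r * ((S ^ 2)⁻¹ * ‖(4 * r) • radiusGrad a y - (2 : ℝ) • (innerSL ℝ y : E3 →L[ℝ] ℝ)‖)
        = |M| * r * (S ^ 2)⁻¹ * ‖(4 * r) • radiusGrad a y -
            (2 : ℝ) • (innerSL ℝ y : E3 →L[ℝ] ℝ)‖ := by ring
      _ ≤ |M| * r * (S ^ 2)⁻¹ * (6 * (r + |a|)) := by gcongr
  have h2 : ‖S⁻¹ • (M • radiusGrad a y)‖ ≤ S⁻¹ * (|M| * (1 + |a| / r)) := by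
    rw [norm_smul, norm_smul, Real.norm_eq_abs, Real.norm_eq_abs, abs_inv, abs_of_pos hSpos]
    have : 0 ≤ S⁻¹ * |M| := by positivity
    calc S⁻¹ * (|M| * ‖radiusGrad a y‖) = S⁻¹ * |M| * ‖radiusGrad a y‖ := by ring
      _ ≤ S⁻¹ * |M| * (1 + |a| / r) := by gcongr
      _ = S⁻¹ * (|M| * (1 + |a| / r)) := by ring
  have hS2 : (S ^ 2)⁻¹ ≤ (r ^ 2 * r ^ 2)⁻¹ := by
    refine inv_anti₀ (by positivity) ?_
    calc r ^ 2 * r ^ 2 ≤ S * S := mul_le_mul hSle hSle (by positivity) hSpos.le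
      _ = S ^ 2 := (sq S).symm
  have hS1 : S⁻¹ ≤ (r ^ 2)⁻¹ := inv_anti₀ (by positivity) hSle
  have hK : 0 ≤ 1 + |a| / r := by positivity
  calc _ ≤ ‖(M * r) • ((-(S ^ 2)⁻¹) • ((4 * r) • radiusGrad a y -
            (2 : ℝ) • (innerSL ℝ y : E3 →L[ℝ] ℝ)))‖ + ‖S⁻¹ • (M • radiusGrad a y)‖ :=
        norm_add_le _ _
    _ ≤ |M| * r * (S ^ 2)⁻¹ * (6 * (r + |a|)) + S⁻¹ * (|M| * (1 + |a| / r)) := add_le_add h1 h2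
    _ ≤ |M| * r * (r ^ 2 * r ^ 2)⁻¹ * (6 * (r + |a|)) + (r ^ 2)⁻¹ * (|M| * (1 + |a| / r)) := by
        gcongr
    _ = 7 * (1 + |a| / r) * |M| / r ^ 2 := by
        field_simp
        ring

/-- `y ↦ ℓ⃗(0, y)` is differentiable wherever `r > 0` (`Kerr.exists_hasFDerivAt_nullSpatial_slice`
on `{r > r/2}`). [folklore] -/
theorem differentiableAt_nullSpatial_slice (hr : 0 < radius a (E4.ofTimeSpace 0 y)) :
    DifferentiableAt ℝ (fun y ↦ nullSpatial a (E4.ofTimeSpace 0 y)) y := by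
  have h2 : 0 < radius a (E4.ofTimeSpace 0 y) / 2 := half_pos hr
  obtain ⟨L', hL', -⟩ := exists_hasFDerivAt_nullSpatial_slice h2
    (mem_slice.2 (by rw [max_eq_left h2.le]; exact half_lt_self hr))
  exact hL'.differentiableAt

/-- **Pointwise bound of the Jacobian of `ℓ⃗`**: `‖D(y ↦ ℓ⃗(0, y))‖ ≤ (21(1 + |a|/r) + 5)/r` at a
point with `r = r(0, y) > 0` — the bound of `Kerr.norm_fderiv_nullSpatial_slice_le` on `{r > r₀}`
for every `r₀ < r`, passed to the limit `r₀ ↑ r`. [folklore] -/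
theorem norm_fderiv_nullSpatial_slice_le_radius (hr : 0 < radius a (E4.ofTimeSpace 0 y)) :
    ‖fderiv ℝ (fun y ↦ nullSpatial a (E4.ofTimeSpace 0 y)) y‖ ≤
      (21 * (1 + |a| / radius a (E4.ofTimeSpace 0 y)) + 5) / radius a (E4.ofTimeSpace 0 y) := by
  refine le_of_forall_lt_of_continuousAt (f := fun r₀ ↦ (21 * (1 + |a| / r₀) + 5) / r₀) hr ?_ ?_
  · have h1 : ContinuousAt (fun r₀ : ℝ ↦ r₀⁻¹) (radius a (E4.ofTimeSpace 0 y)) :=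
      continuousAt_inv₀ hr.ne'
    have heq : (fun r₀ : ℝ ↦ (21 * (1 + |a| / r₀) + 5) / r₀) =
        fun r₀ ↦ (21 * (1 + |a| * r₀⁻¹) + 5) * r₀⁻¹ := by
      funext r₀
      simp only [div_eq_mul_inv]
    rw [heq]
    exact ((continuousAt_const.mul (continuousAt_const.add (continuousAt_const.mul h1))).add
      continuousAt_const).mul h1
  · intro r₀ hr₀ hlt
    exact norm_fderiv_nullSpatial_slice_le hr₀ (mem_slice.2 (by rwa [max_eq_left hr₀.le]))

end Slice

/-! ### On `E4`: `|∂_μ r|`, `|∂_μ H|`, `|∂_μ ℓ^ν|`, `|∂_μ g^{αβ}|` at a point with `r > 0` -/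

section SpaceTime

variable {M a : ℝ} {x : E4}

/-- **`|∂_μ r| ≤ 1 + |a|/r`** at a point of `E4` with `r = r(x) > 0` (`∂_{t*} r = 0`,
`∂_{i+1} r = (∇r)_i`, `Kerr.hasFDerivAt_radius`). Visser arXiv:0706.0622, (35).
[cite: arXiv07060622, (35)] -/
theorem abs_fderiv_radius_basisVector_le (hx : 0 < radius a x) (μ : Fin 4) :
    |fderiv ℝ (radius a) x (E4.basisVector μ)| ≤ 1 + |a| / radius a x := by
  have hr : 0 < radius a (E4.ofTimeSpace 0 (E4.spatial x)) := by rwa [radius_ofTimeSpace_spatial]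
  have h := norm_radiusGrad_le_radius hr
  rw [radius_ofTimeSpace_spatial] at h
  rw [(hasFDerivAt_radius hx).fderiv]
  exact (abs_comp_spatial_basisVector_le _ μ).trans h

/-- `H` on `E4` is the slice function of the spatial part, so its derivative is the slice
derivative composed with the spatial projection (`Kerr.scalarH_add_smul_basisVector_zero`).
[folklore] -/
theorem hasFDerivAt_scalarH (M : ℝ) (hx : 0 < radius a x) :
    HasFDerivAt (scalarH M a)
      ((fderiv ℝ (fun y ↦ scalarH M a (E4.ofTimeSpace 0 y)) (E4.spatial x)).comp E4.spatial) x := by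
  have hr : 0 < radius a (E4.ofTimeSpace 0 (E4.spatial x)) := by rwa [radius_ofTimeSpace_spatial]
  exact hasFDerivAt_of_time_invariant (scalarH_add_smul_basisVector_zero M a)
    (hasFDerivAt_scalarH_slice M hr).differentiableAt.hasFDerivAt

/-- **`|∂_μ H| ≤ 7(1 + |a|/r)|M|/r²`** at a point of `E4` with `r = r(x) > 0`: the `O(M/r²)` decay
of the derivative of the Kerr–Schild scalar `H = M r³/(r⁴ + a²z²)` (DRSR arXiv:1402.7034, §4.6;
Visser arXiv:0706.0622, (33)). [folklore] -/
theorem abs_fderiv_scalarH_basisVector_le (M : ℝ) (hx : 0 < radius a x) (μ : Fin 4) :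
    |fderiv ℝ (scalarH M a) x (E4.basisVector μ)| ≤
      7 * (1 + |a| / radius a x) * |M| / radius a x ^ 2 := by
  have hr : 0 < radius a (E4.ofTimeSpace 0 (E4.spatial x)) := by rwa [radius_ofTimeSpace_spatial]
  have h := norm_fderiv_scalarH_slice_le M hr
  rw [radius_ofTimeSpace_spatial] at h
  rw [(hasFDerivAt_scalarH M hx).fderiv]
  exact (abs_comp_spatial_basisVector_le _ μ).trans h

/-- The spatial components `ℓ^{i+1} = (ℓ⃗)_i` on `E4` are slice functions of the spatial part:
their derivative is the `i`-th row of the slice Jacobian of `ℓ⃗` composed with the spatial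
projection (`Kerr.nullVector_add_smul_basisVector_zero`). [folklore] -/
theorem hasFDerivAt_nullVector_apply_succ (hx : 0 < radius a x) (i : Fin 3) :
    HasFDerivAt (fun z ↦ nullVector a z i.succ)
      (((EuclideanSpace.proj i : E3 →L[ℝ] ℝ).comp
        (fderiv ℝ (fun y ↦ nullSpatial a (E4.ofTimeSpace 0 y)) (E4.spatial x))).comp
          E4.spatial) x := by
  have hr : 0 < radius a (E4.ofTimeSpace 0 (E4.spatial x)) := by rwa [radius_ofTimeSpace_spatial]
  have hS := (differentiableAt_nullSpatial_slice hr).hasFDerivAt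
  have hcomp := (EuclideanSpace.proj (𝕜 := ℝ) i : E3 →L[ℝ] ℝ).hasFDerivAt.comp (E4.spatial x) hS
  have hslice : HasFDerivAt (fun y ↦ nullVector a (E4.ofTimeSpace 0 y) i.succ)
      ((EuclideanSpace.proj i : E3 →L[ℝ] ℝ).comp
        (fderiv ℝ (fun y ↦ nullSpatial a (E4.ofTimeSpace 0 y)) (E4.spatial x))) (E4.spatial x) :=
    hcomp.congr_of_eventuallyEq (Eventually.of_forall fun y ↦ rfl)
  exact hasFDerivAt_of_time_invariant (F := fun z ↦ nullVector a z i.succ)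
    (fun z t ↦ by simp only [nullVector_add_smul_basisVector_zero]) hslice

/-- The components `x ↦ ℓ^ν(x)` are differentiable wherever `r > 0`
(`Kerr.contDiffAt_nullCovectorFun`, `ℓ^ν = ±ℓ_ν`). [folklore] -/
theorem differentiableAt_nullVector_apply (hx : 0 < radius a x) (ν : Fin 4) :
    DifferentiableAt ℝ (fun z ↦ nullVector a z ν) x := by
  have h := ((contDiffAt_nullCovectorFun a hx (n := 1) ν).differentiableAt one_ne_zero).const_mul
    (if ν = 0 then (-1 : ℝ) else 1)
  exact h.congr_of_eventuallyEq (Eventually.of_forall fun z ↦ nullVector_apply a z ν)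

/-- **`|∂_μ ℓ^ν| ≤ (21(1 + |a|/r) + 5)/r`** at a point of `E4` with `r = r(x) > 0`: `ℓ⁰ = −1` is
constant and the spatial components are controlled by the slice Jacobian of `ℓ⃗`
(`Kerr.norm_fderiv_nullSpatial_slice_le_radius`); the `O(1/r)` decay of `∂ℓ` (`ℓ⃗` is the unit
vector `n̂(θ, φ*)`). [folklore] -/
theorem abs_fderiv_nullVector_basisVector_le (hx : 0 < radius a x) (μ ν : Fin 4) :
    |fderiv ℝ (fun z ↦ nullVector a z ν) x (E4.basisVector μ)| ≤
      (21 * (1 + |a| / radius a x) + 5) / radius a x := by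
  have hr : 0 < radius a (E4.ofTimeSpace 0 (E4.spatial x)) := by rwa [radius_ofTimeSpace_spatial]
  refine Fin.cases ?_ (fun i ↦ ?_) ν
  · have h0 : (fun z ↦ nullVector a z 0) = fun _ ↦ (-1 : ℝ) := funext fun z ↦ nullVector_apply_zero a z
    rw [h0]
    simp only [fderiv_fun_const, Pi.zero_apply, zero_apply, abs_zero]
    have := radius_nonneg a x
    positivity
  · have hL := norm_fderiv_nullSpatial_slice_le_radius hr
    rw [radius_ofTimeSpace_spatial] at hL
    rw [(hasFDerivAt_nullVector_apply_succ hx i).fderiv]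
    refine (abs_comp_spatial_basisVector_le _ μ).trans ?_
    refine (ContinuousLinearMap.opNorm_comp_le _ _).trans ?_
    calc ‖(EuclideanSpace.proj i : E3 →L[ℝ] ℝ)‖ *
          ‖fderiv ℝ (fun y ↦ nullSpatial a (E4.ofTimeSpace 0 y)) (E4.spatial x)‖
        ≤ 1 * ((21 * (1 + |a| / radius a x) + 5) / radius a x) :=
          mul_le_mul (norm_proj_le_one i) hL (norm_nonneg _) zero_le_one
      _ = _ := one_mul _

/-- Arithmetic of the product rule for `2H ℓ^β ℓ^α`: with `0 ≤ H ≤ h`, `|ℓ| ≤ 1`, `|dH| ≤ B_H`,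
`|dℓ| ≤ B_ℓ`, the derivative `2Hℓ^β dℓ^α + ℓ^α(2H dℓ^β + ℓ^β · 2dH)` is at most `4hB_ℓ + 2B_H` in
absolute value. [folklore] -/
theorem abs_deriv_two_mul_mul_mul_le {H lα lβ dH dlα dlβ BH Bl h : ℝ} (hH0 : 0 ≤ H)
    (hHle : H ≤ h) (hα : |lα| ≤ 1) (hβ : |lβ| ≤ 1) (hdH : |dH| ≤ BH) (hdα : |dlα| ≤ Bl)
    (hdβ : |dlβ| ≤ Bl) :
    |2 * H * lβ * dlα + lα * (2 * H * dlβ + lβ * (2 * dH))| ≤ 4 * h * Bl + 2 * BH := by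
  have hBl : 0 ≤ Bl := (abs_nonneg _).trans hdα
  have hBH : 0 ≤ BH := (abs_nonneg _).trans hdH
  have hh : 0 ≤ h := hH0.trans hHle
  have h1 : |2 * H * lβ * dlα| ≤ 2 * h * Bl := by
    rw [abs_mul, abs_mul, abs_mul, abs_of_nonneg hH0, abs_two]
    calc 2 * H * |lβ| * |dlα| ≤ 2 * h * 1 * Bl := by gcongr
      _ = 2 * h * Bl := by ring
  have h3 : |2 * H * dlβ + lβ * (2 * dH)| ≤ 2 * h * Bl + 2 * BH := by
    calc _ ≤ |2 * H * dlβ| + |lβ * (2 * dH)| := abs_add_le _ _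
      _ = 2 * H * |dlβ| + |lβ| * (2 * |dH|) := by
          rw [abs_mul, abs_mul, abs_mul, abs_mul, abs_of_nonneg hH0, abs_two]
      _ ≤ 2 * h * Bl + 1 * (2 * BH) := by gcongr
      _ = 2 * h * Bl + 2 * BH := by ring
  have h2 : |lα * (2 * H * dlβ + lβ * (2 * dH))| ≤ 2 * h * Bl + 2 * BH := by
    rw [abs_mul]
    calc |lα| * |2 * H * dlβ + lβ * (2 * dH)| ≤ 1 * (2 * h * Bl + 2 * BH) :=
          mul_le_mul hα h3 (abs_nonneg _) zero_le_one
      _ = 2 * h * Bl + 2 * BH := one_mul _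
  calc _ ≤ |2 * H * lβ * dlα| + |lα * (2 * H * dlβ + lβ * (2 * dH))| := abs_add_le _ _
    _ ≤ 2 * h * Bl + (2 * h * Bl + 2 * BH) := add_le_add h1 h2
    _ = 4 * h * Bl + 2 * BH := by ring

/-- **Decay of the first derivatives of the inverse Kerr metric**: at a point of `E4` with
`r = r(x) > 0`, for `M ≥ 0` and all `μ, α, β`,
`|∂_μ g^{αβ}(x)| ≤ (98(1 + |a|/r) + 20) M/r²` (`g^{αβ} = η^{αβ} − 2Hℓ^βℓ^α`,
`Kerr.inverseMetric_apply`; product rule with `0 ≤ H ≤ M/r`, `|ℓ^ν| ≤ 1`, `|∂H| ≤ 7K|M|/r²`,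
`|∂ℓ| ≤ (21K + 5)/r`). This is the hypothesis `h₁ = O(M/r²)` of
`KerrSchild.multiplierBulk_ge_of_perturbation` for `G = g⁻¹_{M,a}`, `G' = η⁻¹` — the quantitative
content of "this inequality is preserved when `X`, `w` are defined for `g_{M,a}`" (DRSR
arXiv:1402.7034, §4.6; Dafermos–Rodnianski arXiv:1010.5132, §6). [cite: DafermosRodnianskiShlapentokhrothman2014, §4.6] -/
theorem abs_fderiv_inverseMetric_basisVector_le (hM : 0 ≤ M) (hx : 0 < radius a x)
    (μ α β : Fin 4) :
    |fderiv ℝ (fun z ↦ inverseMetric M a z α β) x (E4.basisVector μ)| ≤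
      (98 * (1 + |a| / radius a x) + 20) * M / radius a x ^ 2 := by
  have hH := ((contDiffAt_scalarH M a hx (n := 1)).differentiableAt one_ne_zero).hasFDerivAt
  have hβ := (differentiableAt_nullVector_apply hx β).hasFDerivAt
  have hα := (differentiableAt_nullVector_apply hx α).hasFDerivAt
  have hprod : HasFDerivAt (fun z ↦ 2 * scalarH M a z * nullVector a z β * nullVector a z α)
      ((2 * scalarH M a x * nullVector a x β) • fderiv ℝ (fun z ↦ nullVector a z α) x +
        nullVector a x α • ((2 * scalarH M a x) • fderiv ℝ (fun z ↦ nullVector a z β) x +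
          nullVector a x β • ((2 : ℝ) • fderiv ℝ (scalarH M a) x))) x :=
    ((hH.const_mul 2).mul hβ).mul hα
  have hfun : (fun z ↦ inverseMetric M a z α β) =
      fun z ↦ etaComp α β - 2 * scalarH M a z * nullVector a z β * nullVector a z α := by
    funext z
    rw [inverseMetric_apply, etaComp]
  rw [hfun, (hprod.const_sub (etaComp α β)).fderiv, neg_apply, abs_neg]
  simp only [add_apply, smul_apply, smul_eq_mul]
  refine (abs_deriv_two_mul_mul_mul_le (scalarH_nonneg hM a x) (scalarH_le_div hM a hx)
    (abs_nullVector_le_one hx α) (abs_nullVector_le_one hx β)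
    (abs_fderiv_scalarH_basisVector_le M hx μ) (abs_fderiv_nullVector_basisVector_le hx μ α)
    (abs_fderiv_nullVector_basisVector_le hx μ β)).trans (le_of_eq ?_)
  rw [abs_of_nonneg hM]
  field_simp
  ring

/-- The same on `{r ≥ |a|}` (`K ≤ 2`): **`|∂_μ g^{αβ}(x)| ≤ 216 M/r²`**. [cite: DafermosRodnianskiShlapentokhrothman2014, §4.6] -/
theorem abs_fderiv_inverseMetric_basisVector_le_of_abs_le (hM : 0 ≤ M) (hx : 0 < radius a x)
    (hax : |a| ≤ radius a x) (μ α β : Fin 4) :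
    |fderiv ℝ (fun z ↦ inverseMetric M a z α β) x (E4.basisVector μ)| ≤ 216 * M / radius a x ^ 2 := by
  refine (abs_fderiv_inverseMetric_basisVector_le hM hx μ α β).trans ?_
  have hK : |a| / radius a x ≤ 1 := (div_le_one hx).2 hax
  have : (98 * (1 + |a| / radius a x) + 20) * M ≤ 216 * M := by nlinarith
  exact div_le_div_of_nonneg_right this (by positivity)

/-! ### The two hypotheses of `KerrSchild.multiplierBulk_ge_of_perturbation` for `G = g⁻¹`, `G' = η⁻¹` -/

/-- **`h₀`**: `|(g⁻¹ − η⁻¹)^{αβ}(x)| ≤ 2M/r` at a point with `r > 0`, `M ≥ 0`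
(`Kerr.abs_inverseMetric_sub_etaComp_le` and `H ≤ M/r`), in the form `(G − G') x α β` with
`G = Kerr.inverseMetric M a`, `G' = fun _ ↦ Kerr.etaComp`. Visser arXiv:0706.0622, §5.
[cite: arXiv07060622, §5] -/
theorem abs_inverseMetric_sub_eta_apply_le (hM : 0 ≤ M) (hx : 0 < radius a x) (α β : Fin 4) :
    |(inverseMetric M a - fun _ : E4 ↦ etaComp) x α β| ≤ 2 * M / radius a x := by
  show |inverseMetric M a x α β - etaComp α β| ≤ _
  refine (abs_inverseMetric_sub_etaComp_le hM a hx α β).trans ?_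
  rw [mul_div_assoc]
  exact mul_le_mul_of_nonneg_left (scalarH_le_div hM a hx) zero_le_two

/-- **`h₁`**: `|∂_μ (g⁻¹ − η⁻¹)^{αβ}(x)| ≤ (98(1 + |a|/r) + 20) M/r²` at a point with `r > 0`,
`M ≥ 0`, in the form `(G − G') x α β` (`η⁻¹` is constant). DRSR arXiv:1402.7034, §4.6.
[cite: DafermosRodnianskiShlapentokhrothman2014, §4.6] -/
theorem abs_fderiv_inverseMetric_sub_eta_basisVector_le (hM : 0 ≤ M) (hx : 0 < radius a x)
    (μ α β : Fin 4) :
    |fderiv ℝ (fun z ↦ (inverseMetric M a - fun _ : E4 ↦ etaComp) z α β) x (E4.basisVector μ)| ≤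
      (98 * (1 + |a| / radius a x) + 20) * M / radius a x ^ 2 := by
  have hfun : (fun z ↦ (inverseMetric M a - fun _ : E4 ↦ etaComp) z α β) =
      fun z ↦ inverseMetric M a z α β - etaComp α β := by
    funext z
    rfl
  rw [hfun, fderiv_sub_const]
  exact abs_fderiv_inverseMetric_basisVector_le hM hx μ α β

/-- **`h₁` on `{r ≥ |a|}`**: `|∂_μ (g⁻¹ − η⁻¹)^{αβ}(x)| ≤ 216 M/r²`. [cite: DafermosRodnianskiShlapentokhrothman2014, §4.6] -/
theorem abs_fderiv_inverseMetric_sub_eta_basisVector_le_of_abs_le (hM : 0 ≤ M)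
    (hx : 0 < radius a x) (hax : |a| ≤ radius a x) (μ α β : Fin 4) :
    |fderiv ℝ (fun z ↦ (inverseMetric M a - fun _ : E4 ↦ etaComp) z α β) x (E4.basisVector μ)| ≤
      216 * M / radius a x ^ 2 := by
  have hfun : (fun z ↦ (inverseMetric M a - fun _ : E4 ↦ etaComp) z α β) =
      fun z ↦ inverseMetric M a z α β - etaComp α β := by
    funext z
    rfl
  rw [hfun, fderiv_sub_const]
  exact abs_fderiv_inverseMetric_basisVector_le_of_abs_le hM hx hax μ α β

end SpaceTime

end Literature.Geometry.Lorentzian.Kerr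

end
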